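import Summits.Schanuel.Schanuel.Theorems.ZilberEacComplexPunctureBM
import HarnessLib

/-!
# EC over an algebroid base branch with Brownawell–Masser puncture fibre (abstract form)

The theorems of `ZilberEacComplexPunctureBM.lean` / `…CornerBM.lean` treat `n`-folds whose
additive projection is a *graph* hypersurface `xₙ = g(x')` over a coordinate hyperplane. This file
abstracts the one property of `g` that the proof uses — along the balls `B(2πi m q, ρ m)` the last
coordinate is a holomorphic function `φ_{q,m}(x')` of the others, of polynomial size, with
`Re φ_{q,m} → -∞` faster than every multiple of `log m` — so that *non-graph* bases (branches of
algebraic functions: cyclic covers `xₙ^e = P(x')`, the complex sphere, …; file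
`ZilberEacComplexCyclicCover.lean`) are covered by the same engine, the localized perturbed
Brownawell–Masser theorem `exists_localized_perturbed_of_dominant`.

* `exists_good_direction_of_isOpen_cone` — lattice directions `q` with `Q(2πi q) ≠ 0` inside any
  open cone condition met by one lattice direction (generalizes `exists_good_direction`);
* `norm_finCons_finCons_le` — size of `(e, w, x)`;
* `exists_expPoint_branchBM_avoiding` — **abstract branch-puncture theorem**: `W ⊆ ℂˢ × ℂˢ` a
  Brownawell–Masser variety, `adm ⊆ ℤˢ` a set of directions meeting the complement of every
  hypersurface, and for `q ∈ adm` holomorphic `φ_{q,m}` on `B(2πi m q, ρ_q m)` with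
  `‖φ_{q,m}‖ ≤ K m^N` and `Re φ_{q,m} ≤ -N' log m` (every `N'`, large `m`); then for arbitrary
  `Fⱼ ∈ ℂ[u, w, x']` some `q ∈ adm`, `m`, and `x ∈ B(2πi m q, ρ_q m)` satisfy
  `(x, (e^{xⱼ} - e^{φ} Fⱼ(e^{φ}, φ, x))ⱼ) ∈ W`, `φ = φ_{q,m}(x)`, avoiding any hypersurface `h = 0`.

First open rung of Exponential-Algebraic Closedness: Mantova–Masser, PLMS 129 (2024), §1 p. 5.
HONEST FRAMING: a modest new sub-rung of EAC; nothing here bears on Schanuel's conjecture.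
-/

noncomputable section

open Complex MvPolynomial Metric Set Filter Topology
open Literature.NumberTheory.Transcendental

set_option linter.dupNamespace false

namespace Summit.Schanuel.Schanuel.Theorems

/-! ### Good lattice directions in an open cone -/

/-- **A lattice direction avoiding a hypersurface inside an open cone.** Let `𝒞` be an open
condition on `ℂˢ` stable under positive real dilations and satisfied by the lattice direction
`2πi q₀`. Then for every `Q ≠ 0` some lattice direction `q` has `Q(2πi q) ≠ 0` and `𝒞(2πi q)`
(take `q = q₁ + m q₀` with `Q(2πi q₁) ≠ 0`, `m` large: `2πi q = m · (2πi q₀ + 2πi q₁ / m)`).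
Generalizes `exists_good_direction` (`𝒞(w) = (Re h(w) < 0)`, `h` a form). [folklore] -/
theorem exists_good_direction_of_isOpen_cone {s : ℕ} (Q : MvPolynomial (Fin s) ℂ) (hQ : Q ≠ 0)
    (𝒞 : (Fin s → ℂ) → Prop) (hopen : IsOpen {w | 𝒞 w})
    (hcone : ∀ t : ℝ, 0 < t → ∀ w, 𝒞 w → 𝒞 ((t : ℂ) • w))
    (q₀ : Fin s → ℤ) (hq₀ : 𝒞 (fun j => 2 * Real.pi * I * (q₀ j : ℂ))) :
    ∃ q : Fin s → ℤ, eval (fun j => 2 * Real.pi * I * (q j : ℂ)) Q ≠ 0 ∧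
      𝒞 (fun j => 2 * Real.pi * I * (q j : ℂ)) := by
  classical
  obtain ⟨q₁, hq₁⟩ := Literature.NumberTheory.Transcendental.ExpDominant.exists_int_eval_ne_zero Q hQ
  set v₀ : Fin s → ℂ := fun j => 2 * Real.pi * I * (q₀ j : ℂ) with hv₀
  set v₁ : Fin s → ℂ := fun j => 2 * Real.pi * I * (q₁ j : ℂ) with hv₁
  have hline : ∀ m : ℕ, (fun j => 2 * Real.pi * I * ((q₁ j + (m : ℤ) * q₀ j : ℤ) : ℂ)) =
      v₁ + (m : ℂ) • v₀ := by
    intro m; funext j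
    simp only [hv₀, hv₁, Pi.add_apply, Pi.smul_apply, smul_eq_mul]
    push_cast
    ring
  -- (a) `Q` does not vanish at `v₁ + m v₀` for large `m`
  set Ψ : Polynomial ℂ :=
    MvPolynomial.aeval (fun i => Polynomial.C (v₁ i) + Polynomial.X * Polynomial.C (v₀ i)) Q with hΨ
  have hΨeval : ∀ z : ℂ, Ψ.eval z = eval (v₁ + z • v₀) Q := by
    intro z
    rw [hΨ, ← Polynomial.coe_aeval_eq_eval, ← AlgHom.comp_apply, MvPolynomial.comp_aeval,
      MvPolynomial.aeval_eq_eval]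
    have hF : (fun i => (Polynomial.aeval z) (Polynomial.C (v₁ i) + Polynomial.X * Polynomial.C (v₀ i))) =
        v₁ + z • v₀ := by
      funext i
      simp only [map_add, map_mul, Polynomial.aeval_C, Polynomial.aeval_X, Algebra.algebraMap_self,
        RingHom.id_apply, Pi.add_apply, Pi.smul_apply, smul_eq_mul, mul_comm z]
    rw [hF]
  have hΨ0 : Ψ ≠ 0 := by
    intro h0
    have := hΨeval 0
    rw [h0, Polynomial.eval_zero, zero_smul, add_zero] at this
    exact hq₁ this.symm
  have hevA : ∀ᶠ m : ℕ in atTop, eval (v₁ + (m : ℂ) • v₀) Q ≠ 0 := by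
    have hfin : {m : ℕ | Ψ.IsRoot (m : ℂ)}.Finite :=
      (Polynomial.finite_setOf_isRoot hΨ0).preimage (Nat.cast_injective.injOn)
    obtain ⟨m₀, hm₀⟩ := hfin.bddAbove
    filter_upwards [eventually_gt_atTop m₀] with m hm
    intro hzero
    have hroot : m ∈ {m : ℕ | Ψ.IsRoot (m : ℂ)} := by
      show Ψ.IsRoot (m : ℂ)
      rw [Polynomial.IsRoot, hΨeval, hzero]
    exact absurd (hm₀ hroot) (not_le.mpr hm)
  -- (b) the cone condition persists at `v₁ + m v₀` for large `m`
  have hevB : ∀ᶠ m : ℕ in atTop, 𝒞 (v₁ + (m : ℂ) • v₀) := by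
    have hnhds : ∀ᶠ w in 𝓝 v₀, 𝒞 w := hopen.mem_nhds hq₀
    have htend : Tendsto (fun m : ℕ => v₀ + (m : ℂ)⁻¹ • v₁) atTop (𝓝 v₀) := by
      have h1 : Tendsto (fun m : ℕ => ((m : ℝ)⁻¹ : ℝ)) atTop (𝓝 0) :=
        tendsto_inv_atTop_zero.comp tendsto_natCast_atTop_atTop
      have h2 : Tendsto (fun m : ℕ => ((m : ℂ)⁻¹ : ℂ)) atTop (𝓝 0) := by
        have := (Complex.continuous_ofReal.tendsto 0).comp h1
        simp only [Function.comp_def, Complex.ofReal_inv, Complex.ofReal_natCast,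
          Complex.ofReal_zero] at this
        exact this
      have h3 : Tendsto (fun m : ℕ => (m : ℂ)⁻¹ • v₁) atTop (𝓝 0) := by
        simpa using h2.smul_const v₁
      simpa using h3.const_add v₀
    have hev1 : ∀ᶠ m : ℕ in atTop, 𝒞 (v₀ + (m : ℂ)⁻¹ • v₁) := htend.eventually hnhds
    filter_upwards [hev1, eventually_ge_atTop 1] with m hm hm1
    have hm0 : (m : ℂ) ≠ 0 := by exact_mod_cast (Nat.one_le_iff_ne_zero.mp hm1)
    have hmpos : (0 : ℝ) < m := by exact_mod_cast hm1
    have hscale : v₁ + (m : ℂ) • v₀ = ((m : ℝ) : ℂ) • (v₀ + (m : ℂ)⁻¹ • v₁) := by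
      rw [Complex.ofReal_natCast, smul_add, smul_smul, mul_inv_cancel₀ hm0, one_smul, add_comm]
    rw [hscale]
    exact hcone _ hmpos _ hm
  obtain ⟨m, hmA, hmB⟩ := (hevA.and hevB).exists
  exact ⟨fun j => q₁ j + (m : ℤ) * q₀ j, by rw [hline]; exact hmA, by rw [hline]; exact hmB⟩

/-- Sup-norm of `(e, w, x₁, …, xₛ)` when `‖e‖ ≤ 1`, `‖w‖ ≤ R`, `‖x‖ ≤ R`, `R ≥ 0`: at most `1 + R`.
[folklore] -/
theorem norm_finCons_finCons_le {s : ℕ} {e w : ℂ} {x : Fin s → ℂ} {R : ℝ} (he : ‖e‖ ≤ 1)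
    (hR : 0 ≤ R) (hw : ‖w‖ ≤ R) (hx : ‖x‖ ≤ R) :
    ‖(Fin.cons e (Fin.cons w x : Fin (s + 1) → ℂ) : Fin (s + 2) → ℂ)‖ ≤ 1 + R := by
  refine norm_finCons_le he hR ?_
  rw [pi_norm_le_iff_of_nonneg hR]
  intro i
  refine Fin.cases ?_ (fun j => ?_) i
  · rw [Fin.cons_zero]; exact hw
  · rw [Fin.cons_succ]; exact (norm_le_pi_norm x j).trans hx

/-! ### The abstract branch-puncture theorem -/

/-- **EC over an algebroid base branch with Brownawell–Masser puncture fibre (abstract form), with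
exponential points avoiding any hypersurface.** Let `W ⊆ ℂˢ × ℂˢ` be irreducible Zariski closed of
dimension `s` with dominant additive projection of its torus part (a Brownawell–Masser variety).
Let `adm ⊆ ℤˢ` be a set of lattice directions that meets `{Q ≠ 0}` for every non-zero polynomial
`Q`, and for each `q ∈ adm` let `ρ_q > 0` and functions `φ_{q,m} : ℂˢ → ℂ` be given which, for
all large `m`, are holomorphic on the ball `B(2πi m q, ρ_q m)` with `‖φ_{q,m}‖ ≤ K m^N` there,
and such that for every `N'`, for all large `m`, `Re φ_{q,m} ≤ -N' log m` on that ball (the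
"branch tending to the puncture"). Then for arbitrary `Fⱼ ∈ ℂ[u, w, x₁..xₛ]` and `h ≠ 0` there are
`q ∈ adm`, `m` and `x ∈ B(2πi m q, ρ_q m)` with `h(x) ≠ 0` and
`(x, (e^{xⱼ} - e^{φ} Fⱼ(e^{φ}, φ, x))ⱼ) ∈ W`, `φ = φ_{q,m}(x)`. When `φ_{q,m}` is a branch of an
algebraic function `H(x', xₙ) = 0` this is an exponential point of the `(s+1)`-fold
`{H = 0, (x', (yⱼ - yₙ Fⱼ(yₙ, xₙ, x'))ⱼ) ∈ W}`, whose additive projection is the hypersurface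
`H = 0` (`dim π₁ V = n - 1`, the first open range of Exponential-Algebraic Closedness,
Mantova–Masser 2024 §1 p. 5). The graph case `φ = g ∈ ℂ[x']` is
`exists_expPoint_punctureBM_avoiding`. Proof: the localized perturbed Brownawell–Masser theorem
`exists_localized_perturbed_of_dominant` with `Gⱼ = e^{φ} Fⱼ(e^{φ}, φ, ·)`, small because
`|e^{φ}| ≤ m^{-N'}` beats the polynomial size of `Fⱼ(e^{φ}, φ, x)` on the ball. New.
[cite: MantovaMasser2023, §1 p.5 (the open case dim π(V) = 2 in ℂ³×ℂˣ³)] -/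
theorem exists_expPoint_branchBM_avoiding {s : ℕ}
    (W : Set (Fin s ⊕ Fin s → ℂ)) (hW : IsIrreducibleClosed ℂ W) (hdim : zariskiDim ℂ W = s)
    (hdom : HasDominantAddProjection ℂ (W ∩ torusLocus ℂ s))
    (adm : (Fin s → ℤ) → Prop)
    (hadm : ∀ Q : MvPolynomial (Fin s) ℂ, Q ≠ 0 →
      ∃ q, adm q ∧ eval (fun j => 2 * Real.pi * I * (q j : ℂ)) Q ≠ 0)
    (ρ : (Fin s → ℤ) → ℝ) (φ : (Fin s → ℤ) → ℕ → (Fin s → ℂ) → ℂ)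
    (hφ : ∀ q, adm q → 0 < ρ q ∧ ∃ K : ℝ, 0 ≤ K ∧ ∃ Nφ : ℕ, ∀ᶠ m : ℕ in atTop,
      DifferentiableOn ℂ (φ q m)
        (ball ((m : ℂ) • fun i => 2 * Real.pi * I * (q i : ℂ)) (ρ q * m)) ∧
      ∀ z ∈ ball ((m : ℂ) • fun i => 2 * Real.pi * I * (q i : ℂ)) (ρ q * m),
        ‖φ q m z‖ ≤ K * (m : ℝ) ^ Nφ)
    (hdecay : ∀ q, adm q → ∀ Nd : ℕ, ∀ᶠ m : ℕ in atTop,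
      ∀ z ∈ ball ((m : ℂ) • fun i => 2 * Real.pi * I * (q i : ℂ)) (ρ q * m),
        (φ q m z).re ≤ -(Nd * Real.log m))
    (F : Fin s → MvPolynomial (Fin (s + 2)) ℂ) (h : MvPolynomial (Fin s) ℂ) (hh : h ≠ 0) :
    ∃ q, adm q ∧ ∃ m : ℕ, ∃ x ∈ ball ((m : ℂ) • fun i => 2 * Real.pi * I * (q i : ℂ)) (ρ q * m),
      eval x h ≠ 0 ∧ (Sum.elim x (fun j => exp (x j) - exp (φ q m x) *
        eval (Fin.cons (exp (φ q m x)) (Fin.cons (φ q m x) x : Fin (s + 1) → ℂ)) (F j)) :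
          Fin s ⊕ Fin s → ℂ) ∈ W := by
  classical
  obtain ⟨Q, hQ0, hdir⟩ := exists_localized_perturbed_of_dominant W hW hdim hdom
  set hT : MvPolynomial (Fin s) ℂ := homogeneousComponent h.totalDegree h with hhT
  have hQ'0 : Q * hT ≠ 0 := mul_ne_zero hQ0
    (Literature.NumberTheory.Transcendental.ExpDominant.homogeneousComponent_totalDegree_ne_zero hh)
  obtain ⟨q, hadmq, hqQ'⟩ := hadm (Q * hT) hQ'0
  refine ⟨q, hadmq, ?_⟩
  obtain ⟨hρq, Kφ, hKφ, Nφ, hφev⟩ := hφ q hadmq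
  set v : Fin s → ℂ := fun j => 2 * Real.pi * I * (q j : ℂ) with hv
  rw [map_mul] at hqQ'
  have hqQ : eval v Q ≠ 0 := left_ne_zero_of_mul hqQ'
  have hqh : eval v hT ≠ 0 := right_ne_zero_of_mul hqQ'
  have hεh : 0 < ‖eval v hT‖ / 2 := by positivity
  obtain ⟨ρh, hρh, th, hth, hnearh⟩ :=
    Literature.NumberTheory.Transcendental.ExpDominant.eval_smul_near_top h v hεh
  obtain ⟨ρ', hρ', hρ'le, K, hK, Nn, m₁, hm⟩ := hdir q hqQ (min (ρ q) ρh) (lt_min hρq hρh)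
  have hρ'q : ρ' ≤ ρ q := hρ'le.trans (min_le_left _ _)
  have hρ'h : ρ' ≤ ρh := hρ'le.trans (min_le_right _ _)
  have hgrowth := fun j =>
    Literature.NumberTheory.Transcendental.HypersurfaceCover.exists_norm_eval_le_pow (F j)
  choose C hC N hCN using hgrowth
  set K' : ℝ := ‖v‖ + ρ' + Kφ + 1 with hK'
  have hK'1 : 1 ≤ K' := by rw [hK']; have := norm_nonneg v; linarith
  -- eventual requirements on `m`
  have hsmall : ∀ j, ∀ᶠ m : ℕ in atTop,
      C j * (3 * K') ^ N j * (64 * (s + 1) * (Real.exp 1 * K)) ≤ (m : ℝ) := fun j =>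
    tendsto_natCast_atTop_atTop.eventually_ge_atTop _
  have hall : ∀ᶠ m : ℕ in atTop, ((m₁ ≤ m ∧ th ≤ (m : ℝ)) ∧
      (DifferentiableOn ℂ (φ q m) (ball ((m : ℂ) • v) (ρ q * m)) ∧
        ∀ z ∈ ball ((m : ℂ) • v) (ρ q * m), ‖φ q m z‖ ≤ Kφ * (m : ℝ) ^ Nφ)) ∧
      ∀ j, C j * (3 * K') ^ N j * (64 * (s + 1) * (Real.exp 1 * K)) ≤ (m : ℝ) ∧
        ∀ z ∈ ball ((m : ℂ) • v) (ρ q * m),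
          (φ q m z).re ≤ -(((Nφ + 1) * N j + Nn + 1 : ℕ) * Real.log m) :=
    (((eventually_ge_atTop m₁).and (tendsto_natCast_atTop_atTop.eventually_ge_atTop th)).and
      hφev).and (eventually_all.2 fun j => (hsmall j).and (hdecay q hadmq _))
  obtain ⟨m, ⟨⟨hmm₁, hmth⟩, hφdiff, hφb⟩, hj⟩ := hall.exists
  obtain ⟨hm1, hmain⟩ := hm m hmm₁
  have hm1r : (1 : ℝ) ≤ m := by exact_mod_cast hm1
  have hm0 : (0 : ℝ) < m := by linarith
  have hmC : (m : ℂ) ≠ 0 := by exact_mod_cast hm0.ne'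
  have hlog0 : 0 ≤ Real.log m := Real.log_nonneg hm1r
  have hball : ball ((m : ℂ) • v) (ρ' * m) ⊆ ball ((m : ℂ) • v) (ρ q * m) :=
    ball_subset_ball (mul_le_mul_of_nonneg_right hρ'q hm0.le)
  -- the perturbation
  set G : Fin s → (Fin s → ℂ) → ℂ := fun j z => exp (φ q m z) *
    eval (Fin.cons (exp (φ q m z)) (Fin.cons (φ q m z) z : Fin (s + 1) → ℂ)) (F j) with hG
  have hGdiff : ∀ j, DifferentiableOn ℂ (G j) (ball ((m : ℂ) • v) (ρ' * m)) := by
    intro j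
    have h0 : DifferentiableOn ℂ (φ q m) (ball ((m : ℂ) • v) (ρ' * m)) := hφdiff.mono hball
    have h1 : DifferentiableOn ℂ (fun z => exp (φ q m z)) (ball ((m : ℂ) • v) (ρ' * m)) :=
      h0.cexp
    have h2 : DifferentiableOn ℂ (fun z : Fin s → ℂ =>
        (Fin.cons (exp (φ q m z)) (Fin.cons (φ q m z) z : Fin (s + 1) → ℂ) : Fin (s + 2) → ℂ))
        (ball ((m : ℂ) • v) (ρ' * m)) := by
      refine differentiableOn_pi.2 fun i => ?_
      refine Fin.cases ?_ (fun i' => ?_) i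
      · simp only [Fin.cons_zero]; exact h1
      · simp only [Fin.cons_succ]
        refine Fin.cases ?_ (fun k => ?_) i'
        · simp only [Fin.cons_zero]; exact h0
        · simp only [Fin.cons_succ]; exact (differentiable_apply k).differentiableOn
    exact h1.mul ((differentiable_mvPolynomial_eval (F j)).comp_differentiableOn h2)
  have hGb : ∀ j, ∀ z ∈ ball ((m : ℂ) • v) (ρ' * m),
      ‖G j z‖ ≤ (64 * (s + 1) * (Real.exp 1 * K * (m : ℝ) ^ Nn))⁻¹ := by
    intro j z hz
    have hz' : z ∈ ball ((m : ℂ) • v) (ρ q * m) := hball hz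
    obtain ⟨hjm, hjre⟩ := hj j
    have hre := hjre z hz'
    rw [mem_ball, dist_eq_norm] at hz
    set Nd : ℕ := (Nφ + 1) * N j + Nn + 1 with hNd
    -- `|e^{φ}| ≤ m^{-Nd}` and `≤ 1`
    have hexp_le : ‖exp (φ q m z)‖ ≤ ((m : ℝ) ^ Nd)⁻¹ := by
      rw [Complex.norm_exp]
      refine (Real.exp_le_exp.mpr hre).trans ?_
      rw [Real.exp_neg, Real.exp_nat_mul, Real.exp_log hm0]
    have hexp_le1 : ‖exp (φ q m z)‖ ≤ 1 := by
      rw [Complex.norm_exp]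
      refine Real.exp_le_one_iff.mpr (hre.trans ?_)
      have : (0 : ℝ) ≤ (Nd : ℕ) * Real.log m := by positivity
      linarith
    -- sizes
    have hmN : (m : ℝ) ≤ (m : ℝ) ^ (Nφ + 1) := le_self_pow₀ hm1r (by omega)
    have hmN' : (m : ℝ) ^ Nφ ≤ (m : ℝ) ^ (Nφ + 1) := pow_le_pow_right₀ hm1r (by omega)
    have hzn : ‖z‖ ≤ K' * (m : ℝ) ^ (Nφ + 1) := by
      calc ‖z‖ = ‖(m : ℂ) • v + (z - (m : ℂ) • v)‖ := by rw [add_sub_cancel]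
        _ ≤ ‖(m : ℂ) • v‖ + ‖z - (m : ℂ) • v‖ := norm_add_le _ _
        _ ≤ m * ‖v‖ + ρ' * m := by
            rw [norm_smul, Complex.norm_natCast]; exact add_le_add le_rfl hz.le
        _ = (‖v‖ + ρ') * m := by ring
        _ ≤ K' * (m : ℝ) ^ (Nφ + 1) := by
            refine mul_le_mul ?_ hmN hm0.le (by positivity)
            rw [hK']; linarith
    have hφn : ‖φ q m z‖ ≤ K' * (m : ℝ) ^ (Nφ + 1) := by
      refine (hφb z hz').trans (mul_le_mul ?_ hmN' (by positivity) (by positivity))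
      rw [hK']; have := norm_nonneg v; linarith
    have hcons : ‖(Fin.cons (exp (φ q m z)) (Fin.cons (φ q m z) z : Fin (s + 1) → ℂ) :
        Fin (s + 2) → ℂ)‖ ≤ 1 + K' * (m : ℝ) ^ (Nφ + 1) :=
      norm_finCons_finCons_le hexp_le1 (by positivity) hφn hzn
    have hFb : ‖eval (Fin.cons (exp (φ q m z)) (Fin.cons (φ q m z) z : Fin (s + 1) → ℂ)) (F j)‖ ≤
        C j * ((3 * K') * (m : ℝ) ^ (Nφ + 1)) ^ N j := by
      refine (hCN j _).trans (mul_le_mul_of_nonneg_left ?_ (hC j))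
      refine pow_le_pow_left₀ (by positivity) ?_ _
      have : (1 : ℝ) ≤ K' * (m : ℝ) ^ (Nφ + 1) := by
        have h1 : (1 : ℝ) ≤ (m : ℝ) ^ (Nφ + 1) := one_le_pow₀ hm1r
        nlinarith
      linarith
    have hpos : (0 : ℝ) < 64 * (s + 1) * (Real.exp 1 * K * (m : ℝ) ^ Nn) := by positivity
    have hGz : ‖G j z‖ ≤ ((m : ℝ) ^ Nd)⁻¹ * (C j * ((3 * K') * (m : ℝ) ^ (Nφ + 1)) ^ N j) := by
      show ‖exp (φ q m z) * eval (Fin.cons (exp (φ q m z)) (Fin.cons (φ q m z) z)) (F j)‖ ≤ _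
      rw [norm_mul]
      exact mul_le_mul hexp_le hFb (norm_nonneg _) (by positivity)
    rw [← one_div, le_div_iff₀ hpos]
    have hmNd : (m : ℝ) ^ Nd = ((m : ℝ) ^ (Nφ + 1)) ^ N j * (m : ℝ) ^ Nn * m := by
      rw [hNd, pow_add, pow_add, pow_one, pow_mul]
    calc ‖G j z‖ * (64 * (s + 1) * (Real.exp 1 * K * (m : ℝ) ^ Nn))
        ≤ ((m : ℝ) ^ Nd)⁻¹ * (C j * ((3 * K') * (m : ℝ) ^ (Nφ + 1)) ^ N j) *
            (64 * (s + 1) * (Real.exp 1 * K * (m : ℝ) ^ Nn)) :=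
          mul_le_mul_of_nonneg_right hGz hpos.le
      _ = C j * (3 * K') ^ N j * (64 * (s + 1) * (Real.exp 1 * K)) / m := by
          rw [hmNd, mul_pow]
          field_simp
      _ ≤ 1 := by rw [div_le_one hm0]; exact hjm
  obtain ⟨x, hxball, hx⟩ := hmain G hGdiff hGb
  refine ⟨m, x, hball hxball, ?_, hx⟩
  -- the solution avoids the hypersurface `h = 0`
  rw [mem_ball, dist_eq_norm] at hxball
  set ζ : Fin s → ℂ := (m : ℂ)⁻¹ • (x - (m : ℂ) • v) with hζ
  have hxζ : x = ((m : ℝ) : ℂ) • (v + ζ) := by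
    rw [Complex.ofReal_natCast, hζ, smul_add, smul_smul, mul_inv_cancel₀ hmC, one_smul,
      add_sub_cancel]
  have hζρ : ‖ζ‖ ≤ ρh := by
    rw [hζ, norm_smul, norm_inv, Complex.norm_natCast, inv_mul_le_iff₀ hm0, mul_comm]
    exact hxball.le.trans (mul_le_mul_of_nonneg_right hρ'h hm0.le)
  have hnh := hnearh m hmth ζ hζρ
  rw [← hxζ, Complex.ofReal_natCast] at hnh
  intro hzero
  rw [hzero, zero_sub, norm_neg, norm_mul, norm_pow, Complex.norm_natCast] at hnh
  have hmd : (0 : ℝ) < (m : ℝ) ^ h.totalDegree := by positivity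
  have : ‖eval v hT‖ ≤ ‖eval v hT‖ / 2 := le_of_mul_le_mul_left (by linarith [hnh]) hmd
  have hpos : 0 < ‖eval v hT‖ := norm_pos_iff.mpr hqh
  linarith

end Summit.Schanuel.Schanuel.Theorems
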